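import Literature.ModelTheory.FiniteModelTheory.CohomologicalConsistencyClosure
import Mathlib.Combinatorics.SimpleGraph.Finite
import Mathlib.Algebra.Order.BigOperators.Group.Finset
import Mathlib.Tactic.Ring
import HarnessLib

/-!
# Descendants along a colour-compatible order: layers, size, chains
# (Conneryd–Ghannane–Pang 2025 §6 / [CdRNPR25] Def. 3.4, Obs. 3.5)

Topic `Literature/ModelTheory/FiniteModelTheory`.  Bottom-up formalisation of the named fact
`connerydGhannanePang2025_thm_6_1`: the SIZE LEMMA for closures (CGP Lemma 6.7 = [CdRNPR25,
Lemma 5.4]) needs the set of descendants `Desc(S)` of a vertex set in a linearly ordered graph and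
the bound `|Desc(S)| ≤ c·d^{c-1}·|S|` when the order is a `χ`-ORDERING of a proper `c`-colouring
and degrees are `≤ d` ([CdRNPR25] Obs. 3.5: decreasing paths have `≤ c` vertices, since colours
strictly decrease along decreasing edges).  We render `Desc` by LAYERS, which avoids path theory:

* `decStep G S` — the smaller neighbours of `S`; `decLayer G t S` — its `t`-th iterate (the ends of
  the decreasing walks of length `t` from `S`, automatically simple); `desc G c S = ⋃_{t<c} layers`.
* `IsChiOrdering G χ` (Def. 3.4): `χ` proper and `u < v ⇒ χ u ≤ χ v`; then colours strictly drop
  along decreasing edges (`chi_lt_of_adj_lt`), layer `t` has colours `≤ c-1-t`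
  (`chi_add_le_of_mem_decLayer`), so `decLayer G c S = ∅` and `desc G c S` is DESCENDANT-CLOSED
  (`isDescClosed_desc`), the least such superset (`desc_subset_of_isDescClosed`), in particular
  `desc G c S ⊆ cl G S'` for `S ⊆ S'` (`desc_subset_cl`).
* SIZE (Obs. 3.5): `card_decStep_le` (`≤ d|S|`), `card_decLayer_le` (`≤ d^t|S|`),
  `card_desc_le : |desc| ≤ c·d^{c-1}·|S|` for `d ≥ 1`.
* CHAINS: `mem_decLayer_iff_chain` — membership in layer `t` is witnessed by a decreasing chain
  `w 0 ∈ S, w t = v, w (i+1) < w i ~ w (i+1)`; all its vertices lie in `desc` (`chain_mem_desc`).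

## References

* [ConnerydGhannanePang2025] arXiv:2511.17272 §6 (ordering by colour classes; `|Desc(U)| ≤
  d^{χ-1}|U|`). READ.
* [CdRNPR25] arXiv:2503.17022, Def. 3.4 (`χ`-ordering), Obs. 3.5. READ.
-/

namespace Literature.ModelTheory.FiniteModelTheory

namespace ConnerydGhannanePang

open Finset

variable {V : Type*} [LinearOrder V] [Fintype V] (G : SimpleGraph V) [DecidableRel G.Adj]

/-! ### Layers of descendants -/

/-- One decreasing step: the smaller neighbours of the vertices of `S`. [cite: ConnerydGhannanePang2025, §6 (descendants)] -/
def decStep (S : Finset V) : Finset V :=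
  S.biUnion fun u => (G.neighborFinset u).filter fun v => v < u

/-- The `t`-th layer of descendants: ends of decreasing walks of length `t` from `S`.
[cite: ConnerydGhannanePang2025, §6 (descendants)] -/
def decLayer : ℕ → Finset V → Finset V
  | 0, S => S
  | t + 1, S => decStep G (decLayer t S)

/-- Descendants within `c - 1` steps: `⋃_{t < c} decLayer t S` (all of `Desc(S)` under a
`χ`-ordering with `c` colours). [cite: ConnerydGhannanePang2025, §6 (descendants)] -/
def desc (c : ℕ) (S : Finset V) : Finset V :=
  (Finset.range c).biUnion fun t => decLayer G t S

variable {G}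

/-- Membership in `decStep`. [folklore] -/
theorem mem_decStep {S : Finset V} {v : V} : v ∈ decStep G S ↔ ∃ u ∈ S, G.Adj u v ∧ v < u := by
  simp [decStep]

/-- Membership in `desc`. [folklore] -/
theorem mem_desc {c : ℕ} {S : Finset V} {v : V} : v ∈ desc G c S ↔ ∃ t < c, v ∈ decLayer G t S := by
  simp [desc]

/-- `decLayer 0 S = S`. [folklore] -/
@[simp] theorem decLayer_zero (S : Finset V) : decLayer G 0 S = S := rfl

/-- `decLayer (t+1) S = decStep (decLayer t S)`. [folklore] -/
theorem decLayer_succ (t : ℕ) (S : Finset V) : decLayer G (t + 1) S = decStep G (decLayer G t S) := rfl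

/-- `S ⊆ desc c S` for `c ≥ 1`. [folklore] -/
theorem subset_desc {c : ℕ} (hc : 1 ≤ c) (S : Finset V) : S ⊆ desc G c S :=
  fun _ hv => mem_desc.2 ⟨0, hc, hv⟩

/-- `decStep` is monotone. [folklore] -/
theorem decStep_mono {S T : Finset V} (h : S ⊆ T) : decStep G S ⊆ decStep G T := by
  intro v hv
  obtain ⟨u, hu, huv, hlt⟩ := mem_decStep.1 hv
  exact mem_decStep.2 ⟨u, h hu, huv, hlt⟩

/-- Layers are monotone in the start set. [folklore] -/
theorem decLayer_mono {S T : Finset V} (h : S ⊆ T) : ∀ t, decLayer G t S ⊆ decLayer G t T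
  | 0 => h
  | t + 1 => decStep_mono (decLayer_mono h t)

/-- `desc` is monotone in the start set. [folklore] -/
theorem desc_mono {c : ℕ} {S T : Finset V} (h : S ⊆ T) : desc G c S ⊆ desc G c T := by
  intro v hv
  obtain ⟨t, ht, hv⟩ := mem_desc.1 hv
  exact mem_desc.2 ⟨t, ht, decLayer_mono h t hv⟩

/-- A descendant-closed set is stable under `decStep`. [folklore] -/
theorem decStep_subset_of_isDescClosed {W : Finset V} (hW : IsDescClosed G W) : decStep G W ⊆ W := by
  intro v hv
  obtain ⟨u, hu, huv, hlt⟩ := mem_decStep.1 hv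
  exact hW hu huv hlt

/-- A descendant-closed superset of `S` contains all layers. [folklore] -/
theorem decLayer_subset_of_isDescClosed {S W : Finset V} (hSW : S ⊆ W) (hW : IsDescClosed G W) :
    ∀ t, decLayer G t S ⊆ W
  | 0 => hSW
  | t + 1 => (decStep_mono (decLayer_subset_of_isDescClosed hSW hW t)).trans
      (decStep_subset_of_isDescClosed hW)

/-- MINIMALITY: a descendant-closed superset of `S` contains `desc c S`. [folklore] -/
theorem desc_subset_of_isDescClosed {c : ℕ} {S W : Finset V} (hSW : S ⊆ W) (hW : IsDescClosed G W) :
    desc G c S ⊆ W := by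
  intro v hv
  obtain ⟨t, -, hv⟩ := mem_desc.1 hv
  exact decLayer_subset_of_isDescClosed hSW hW t hv

/-- In particular `desc c S ⊆ cl S'` whenever `S ⊆ S'` (closures are descendant-closed).
[cite: ConnerydGhannanePang2025, Def. 6.6] -/
theorem desc_subset_cl {c : ℕ} {S S' : Finset V} (h : S ⊆ S') : desc G c S ⊆ cl G S' :=
  desc_subset_of_isDescClosed (h.trans (subset_cl S')) (isClosed_cl S').desc

/-! ### `χ`-orderings (Definition 3.4 of [CdRNPR25]) -/

variable (G) in
/-- `χ : V → ℕ` is a PROPER colouring and the linear order on `V` is a `χ`-ORDERING: `u < v`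
forces `χ u ≤ χ v` (equivalently `χ u < χ v ⇒ u < v`). [cite: ConnerydGhannanePang2025, §6 (ordering by colour classes)] -/
def IsChiOrdering (χ : V → ℕ) : Prop :=
  (∀ ⦃u v : V⦄, G.Adj u v → χ u ≠ χ v) ∧ ∀ ⦃u v : V⦄, u < v → χ u ≤ χ v

omit [Fintype V] [DecidableRel G.Adj] in
/-- Colours strictly drop along decreasing edges. [cite: ConnerydGhannanePang2025, §6] -/
theorem IsChiOrdering.chi_lt_of_adj_lt {χ : V → ℕ} (hχ : IsChiOrdering G χ) {u v : V} (huv : G.Adj u v)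
    (hvu : v < u) : χ v < χ u :=
  lt_of_le_of_ne (hχ.2 hvu) fun h => hχ.1 huv h.symm

/-- Layer `t` loses `t` colours: `χ v + t ≤ χ s` for some... globally, `χ v + t ≤ c - 1` when all
colours are `< c`. [cite: ConnerydGhannanePang2025, §6 (decreasing paths have `≤ χ` vertices)] -/
theorem IsChiOrdering.chi_add_le_of_mem_decLayer {χ : V → ℕ} (hχ : IsChiOrdering G χ) {c : ℕ}
    (hc : ∀ v, χ v < c) {S : Finset V} : ∀ (t : ℕ) {v : V}, v ∈ decLayer G t S → χ v + t + 1 ≤ c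
  | 0, v, _ => by have := hc v; omega
  | t + 1, v, hv => by
    rw [decLayer_succ] at hv
    obtain ⟨u, hu, huv, hlt⟩ := mem_decStep.1 hv
    have h1 := chi_add_le_of_mem_decLayer hχ hc t hu
    have h2 := hχ.chi_lt_of_adj_lt huv hlt
    omega

/-- Hence the `c`-th layer is empty. [cite: ConnerydGhannanePang2025, §6] -/
theorem IsChiOrdering.decLayer_eq_empty {χ : V → ℕ} (hχ : IsChiOrdering G χ) {c : ℕ}
    (hc : ∀ v, χ v < c) (S : Finset V) {t : ℕ} (ht : c ≤ t) : decLayer G t S = ∅ := by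
  rw [Finset.eq_empty_iff_forall_notMem]
  intro v hv
  have := hχ.chi_add_le_of_mem_decLayer hc t hv
  omega

/-- **`desc c S` is descendant-closed** under a `χ`-ordering with colours `< c`.
[cite: ConnerydGhannanePang2025, §6] -/
theorem IsChiOrdering.isDescClosed_desc {χ : V → ℕ} (hχ : IsChiOrdering G χ) {c : ℕ}
    (hc : ∀ v, χ v < c) (S : Finset V) : IsDescClosed G (desc G c S) := by
  intro u hu v huv hvu
  obtain ⟨t, ht, hu⟩ := mem_desc.1 hu
  have hv : v ∈ decLayer G (t + 1) S := by
    rw [decLayer_succ]; exact mem_decStep.2 ⟨u, hu, huv, hvu⟩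
  refine mem_desc.2 ⟨t + 1, lt_of_le_of_ne (Nat.succ_le_of_lt ht) fun h => ?_, hv⟩
  rw [hχ.decLayer_eq_empty hc S (le_of_eq h.symm)] at hv
  simp at hv

/-- `desc` is idempotent-like: `desc c (desc c S) = desc c S` under a `χ`-ordering. [folklore] -/
theorem IsChiOrdering.desc_desc {χ : V → ℕ} (hχ : IsChiOrdering G χ) {c : ℕ} (hc : ∀ v, χ v < c)
    (hc1 : 1 ≤ c) (S : Finset V) : desc G c (desc G c S) = desc G c S :=
  Finset.Subset.antisymm (desc_subset_of_isDescClosed Finset.Subset.rfl (hχ.isDescClosed_desc hc S))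
    (subset_desc hc1 _)

/-! ### Size (Observation 3.5) -/

/-- `|decStep S| ≤ d |S|` when all degrees are `≤ d`. [cite: ConnerydGhannanePang2025, §6] -/
theorem card_decStep_le {d : ℕ} (hd : ∀ v, G.degree v ≤ d) (S : Finset V) :
    (decStep G S).card ≤ d * S.card := by
  calc (decStep G S).card ≤ ∑ u ∈ S, ((G.neighborFinset u).filter fun v => v < u).card :=
        Finset.card_biUnion_le
    _ ≤ ∑ _u ∈ S, d := Finset.sum_le_sum fun u _ =>
        (Finset.card_le_card (Finset.filter_subset _ _)).trans
          (by rw [SimpleGraph.card_neighborFinset_eq_degree]; exact hd u)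
    _ = d * S.card := by rw [Finset.sum_const, smul_eq_mul, mul_comm]

/-- `|decLayer t S| ≤ d^t |S|`. [cite: ConnerydGhannanePang2025, §6] -/
theorem card_decLayer_le {d : ℕ} (hd : ∀ v, G.degree v ≤ d) (S : Finset V) :
    ∀ t, (decLayer G t S).card ≤ d ^ t * S.card
  | 0 => by simp
  | t + 1 => by
    rw [decLayer_succ, pow_succ]
    calc (decStep G (decLayer G t S)).card ≤ d * (decLayer G t S).card := card_decStep_le hd _
      _ ≤ d * (d ^ t * S.card) := Nat.mul_le_mul_left _ (card_decLayer_le hd S t)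
      _ = d ^ t * d * S.card := by rw [← mul_assoc, mul_comm d]

/-- **Observation 3.5**: `|desc c S| ≤ c · d^{c-1} · |S|` (`d ≥ 1`). [cite: ConnerydGhannanePang2025, §6 (`|Desc(U)| ≤ d^{χ(G)-1}|U|`-type bound)] -/
theorem card_desc_le {d : ℕ} (hd1 : 1 ≤ d) (hd : ∀ v, G.degree v ≤ d) (c : ℕ) (S : Finset V) :
    (desc G c S).card ≤ c * d ^ (c - 1) * S.card := by
  calc (desc G c S).card ≤ ∑ t ∈ Finset.range c, (decLayer G t S).card := Finset.card_biUnion_le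
    _ ≤ ∑ t ∈ Finset.range c, d ^ (c - 1) * S.card := Finset.sum_le_sum fun t ht =>
        (card_decLayer_le hd S t).trans (Nat.mul_le_mul_right _
          (Nat.pow_le_pow_right hd1 (Nat.le_sub_one_of_lt (Finset.mem_range.1 ht))))
    _ = c * d ^ (c - 1) * S.card := by rw [Finset.sum_const, Finset.card_range, smul_eq_mul, mul_assoc]

/-! ### Decreasing chains -/

variable (G) in
/-- `w` is a DECREASING CHAIN of length `t` from `S` to `v`: `w 0 ∈ S`, `w t = v`, consecutive
vertices adjacent and decreasing. [cite: ConnerydGhannanePang2025, §6 (decreasing paths)] -/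
def IsDecChain (S : Finset V) (t : ℕ) (v : V) (w : ℕ → V) : Prop :=
  w 0 ∈ S ∧ w t = v ∧ ∀ i < t, G.Adj (w i) (w (i + 1)) ∧ w (i + 1) < w i

/-- Layer membership is witnessed by a decreasing chain. [folklore] -/
theorem exists_chain_of_mem_decLayer {S : Finset V} :
    ∀ (t : ℕ) {v : V}, v ∈ decLayer G t S → ∃ w : ℕ → V, IsDecChain G S t v w
  | 0, v, hv => ⟨fun _ => v, hv, rfl, fun i hi => absurd hi (Nat.not_lt_zero i)⟩
  | t + 1, v, hv => by
    rw [decLayer_succ] at hv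
    obtain ⟨u, hu, huv, hlt⟩ := mem_decStep.1 hv
    obtain ⟨w, hw0, hwt, hw⟩ := exists_chain_of_mem_decLayer t hu
    refine ⟨fun i => if i ≤ t then w i else v, by simpa using hw0, by simp, fun i hi => ?_⟩
    rcases Nat.lt_succ_iff_lt_or_eq.1 hi with hi | rfl
    · have h1 : i ≤ t := le_of_lt hi
      have h2 : i + 1 ≤ t := hi
      simp only [h1, h2, if_true]
      exact hw i hi
    · simp only [le_refl, if_true, Nat.not_succ_le_self, if_false, hwt]
      exact ⟨huv, hlt⟩

/-- The vertices of a decreasing chain from `S` lie in the corresponding layers. [folklore] -/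
theorem chain_mem_decLayer {S : Finset V} {t : ℕ} {v : V} {w : ℕ → V} (hw : IsDecChain G S t v w) :
    ∀ i ≤ t, w i ∈ decLayer G i S
  | 0, _ => hw.1
  | i + 1, hi => by
    rw [decLayer_succ]
    have h := hw.2.2 i (Nat.lt_of_succ_le hi)
    exact mem_decStep.2 ⟨w i, chain_mem_decLayer hw i (Nat.le_of_succ_le hi), h.1, h.2⟩

/-- The vertices of a decreasing chain of length `t < c` from `S` lie in `desc c S`. [folklore] -/
theorem chain_mem_desc {c : ℕ} {S : Finset V} {t : ℕ} (ht : t < c) {v : V} {w : ℕ → V}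
    (hw : IsDecChain G S t v w) {i : ℕ} (hi : i ≤ t) : w i ∈ desc G c S :=
  mem_desc.2 ⟨i, lt_of_le_of_lt hi ht, chain_mem_decLayer hw i hi⟩

omit [Fintype V] [DecidableRel G.Adj] in
/-- A decreasing chain is strictly decreasing, hence injective on `[0, t]`. [folklore] -/
theorem chain_strictAnti {S : Finset V} {t : ℕ} {v : V} {w : ℕ → V} (hw : IsDecChain G S t v w)
    {i j : ℕ} (hij : i < j) (hj : j ≤ t) : w j < w i := by
  induction j with
  | zero => exact absurd hij (Nat.not_lt_zero i)
  | succ j ih =>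
    have hstep : w (j + 1) < w j := (hw.2.2 j (Nat.lt_of_succ_le hj)).2
    rcases Nat.lt_succ_iff_lt_or_eq.1 hij with h | rfl
    · exact hstep.trans (ih h (Nat.le_of_succ_le hj))
    · exact hstep

/-- Members of `desc c S` are reached by a decreasing chain of length `< c`. [folklore] -/
theorem exists_chain_of_mem_desc {c : ℕ} {S : Finset V} {v : V} (hv : v ∈ desc G c S) :
    ∃ t < c, ∃ w : ℕ → V, IsDecChain G S t v w := by
  obtain ⟨t, ht, hv⟩ := mem_desc.1 hv
  obtain ⟨w, hw⟩ := exists_chain_of_mem_decLayer t hv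
  exact ⟨t, ht, w, hw⟩

end ConnerydGhannanePang

end Literature.ModelTheory.FiniteModelTheory
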